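import Mathlib
import HarnessLib
import Summits.Ventures.LatticeQCDFlow.Scoring.AcceptanceMonitorConcentrationIntegral

/-!
# LatticeQCDFlow / Scoring — the bias of an UNCORRECTED flow sampler on a GENERAL space:
# `|E_q f − E_p f| ≤ σ_q(f)·√(1/ESS − 1)`, with equality for observables affine in the weight

HONEST FRAMING: exact (Metropolis-corrected) sampling algorithms for lattice gauge theory;
figures of merit are autocorrelation/cost numbers at stated couplings and volumes; no
continuum-physics claim.

Venture `LatticeQCDFlow` (cell pub-lqcd), sub-topic `Scoring`; FANOUT row 3 (`s0-u1-a`, S0-B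
implementation A, GEN-10).  The MEASURE-THEORETIC form of row 3's `Scoring/UncorrectedFlowBias`
(GEN-7, finite configuration spaces: the planted control INVALID-1 / X-1 "Metropolis step
disabled" samples the MODEL `q` instead of the target `p`).  NEW WORK of the cell (one covariance
identity, one Cauchy–Schwarz step by the discriminant, over Bochner integrals); the `χ²` change-of-
measure bound is [folklore]; NO definition is introduced.  Vocabulary of row 4 / row 3's
general-space files: a reference measure `μ` on a measurable space `X`, densities `p` (target,
`∫ p = 1`) and `q > 0` (model, `∫ q = 1`), importance weight `w = p/q`,
`V = ∫ (w − 1)² q dμ = W − 1 = 1/ESS − 1` (`W = ∫ (p/q) p dμ`,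
`AllPairsVariance.integral_weightVar_eq`, imported), an observable `f` with `f q`, `f p`, `f² q`
integrable.

* `uncorrected_bias_eq_weightCov_integral` — for every centre `c`:
  `∫ f p − ∫ f q = ∫ (w − 1)(f − c) q` (`= Cov_q(w, f)`);
* **`sq_uncorrected_bias_le_integral`** — `(∫ f p − ∫ f q)² ≤ (∫ (f − c)² q)·V` for every `c`
  (Cauchy–Schwarz via the discriminant of `t ↦ ∫ ((f − c) − t(w − 1))² q ≥ 0`);
  `abs_uncorrected_bias_le_integral` — `|∫ f p − ∫ f q| ≤ √(∫ (f − c)² q)·√V`;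
* **`uncorrected_bias_affine_integral`** — EQUALITY for `f = a + b·w`: the bias is exactly `b·V`;
  in particular the uncorrected sampler under-reports the mean weight by exactly `V = χ²(p‖q)`.

Reading (value-free): on continuous field space as on finite ones, an uncorrected flow is off on an
observable `f` by at most `σ_q(f)·√(1/ESS − 1)` and this is attained, so the plaquette prong of the
planted-invalid test can only see the defect through `1/ESS − 1`.  NOT CLAIMED: any bias, ESS or
flag of ours; the second prong (constant `accepted` field) is not a statement about measures.
-/

namespace Summit.Ventures.LatticeQCDFlow.Scoring

open MeasureTheory

section Uncorrected

variable {X : Type*} [MeasurableSpace X] {μ : Measure X} {p q f : X → ℝ}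

omit [MeasurableSpace X] in
/-- Pointwise bookkeeping: `(w − 1)(f − c)·q = f p − f q − c p + c q` for `q > 0`. [folklore] -/
theorem weightCov_integrand_eq (hq0 : ∀ y, 0 < q y) (c : ℝ) (y : X) :
    (p y / q y - 1) * (f y - c) * q y = f y * p y - f y * q y - c * p y + c * q y := by
  have hq := (hq0 y).ne'
  field_simp
  ring

/-- **The bias of the uncorrected sampler is the model covariance of `f` with the weight**: for
every centre `c`, `∫ f p dμ − ∫ f q dμ = ∫ (w − 1)(f − c) q dμ`. [ours] -/
theorem uncorrected_bias_eq_weightCov_integral (hq0 : ∀ y, 0 < q y) (hpi : Integrable p μ)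
    (hp1 : ∫ y, p y ∂μ = 1) (hqi : Integrable q μ) (hq1 : ∫ y, q y ∂μ = 1)
    (hfp : Integrable (fun y => f y * p y) μ) (hfq : Integrable (fun y => f y * q y) μ) (c : ℝ) :
    (∫ y, f y * p y ∂μ) - ∫ y, f y * q y ∂μ = ∫ y, (p y / q y - 1) * (f y - c) * q y ∂μ := by
  simp_rw [weightCov_integrand_eq hq0 c]
  have h1 : Integrable (fun y => f y * p y - f y * q y) μ := hfp.sub hfq
  have h2 : Integrable (fun y => f y * p y - f y * q y - c * p y) μ := h1.sub (hpi.const_mul c)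
  rw [integral_add h2 (hqi.const_mul c), integral_sub h1 (hpi.const_mul c), integral_sub hfp hfq,
    integral_const_mul, integral_const_mul, hp1, hq1]
  ring

omit [MeasurableSpace X] in
/-- Pointwise bookkeeping: `(w − 1)²·q = (p/q)p − 2p + q` for `q > 0`. [folklore] -/
theorem weightVar_integrand_eq (hq0 : ∀ y, 0 < q y) (y : X) :
    (p y / q y - 1) ^ 2 * q y = p y / q y * p y - 2 * p y + q y := by
  have hq := (hq0 y).ne'
  field_simp
  ring

/-- `(w − 1)²·q` is `μ`-integrable when the weight moment `W = ∫ (p/q)p dμ` is finite. [folklore] -/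
theorem integrable_weightVar_integrand (hq0 : ∀ y, 0 < q y) (hpi : Integrable p μ)
    (hqi : Integrable q μ) (hW : Integrable (fun y => p y / q y * p y) μ) :
    Integrable (fun y => (p y / q y - 1) ^ 2 * q y) μ := by
  simp_rw [weightVar_integrand_eq hq0]
  exact (hW.sub (hpi.const_mul 2)).add hqi

/-- **THE `χ²` BOUND (Cauchy–Schwarz)**: for every centre `c`,
`(∫ f p − ∫ f q)² ≤ (∫ (f − c)² q dμ)·(∫ (w − 1)² q dμ)` — the squared bias is at most the model
variance of `f` (about `c`) times `1/ESS − 1`.  Proof: the discriminant of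
`t ↦ ∫ ((f − c) − t(w − 1))² q ≥ 0`. [folklore] -/
theorem sq_uncorrected_bias_le_integral (hq0 : ∀ y, 0 < q y) (hpi : Integrable p μ)
    (hp1 : ∫ y, p y ∂μ = 1) (hqi : Integrable q μ) (hq1 : ∫ y, q y ∂μ = 1)
    (hW : Integrable (fun y => p y / q y * p y) μ) (hfp : Integrable (fun y => f y * p y) μ)
    (hfq : Integrable (fun y => f y * q y) μ) (hf2 : Integrable (fun y => f y ^ 2 * q y) μ)
    (c : ℝ) :
    ((∫ y, f y * p y ∂μ) - ∫ y, f y * q y ∂μ) ^ 2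
      ≤ (∫ y, (f y - c) ^ 2 * q y ∂μ) * ∫ y, (p y / q y - 1) ^ 2 * q y ∂μ := by
  set A := ∫ y, (f y - c) ^ 2 * q y ∂μ with hA
  set B := ∫ y, (p y / q y - 1) * (f y - c) * q y ∂μ with hB
  set C := ∫ y, (p y / q y - 1) ^ 2 * q y ∂μ with hC
  rw [uncorrected_bias_eq_weightCov_integral hq0 hpi hp1 hqi hq1 hfp hfq c, ← hB]
  -- integrability of the three pieces
  have iA : Integrable (fun y => (f y - c) ^ 2 * q y) μ := by
    have e : ∀ y, (f y - c) ^ 2 * q y = f y ^ 2 * q y - 2 * c * (f y * q y) + c ^ 2 * q y :=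
      fun y => by ring
    simp_rw [e]
    exact (hf2.sub (hfq.const_mul _)).add (hqi.const_mul _)
  have iB : Integrable (fun y => (p y / q y - 1) * (f y - c) * q y) μ := by
    simp_rw [weightCov_integrand_eq hq0 c]
    exact ((hfp.sub hfq).sub (hpi.const_mul c)).add (hqi.const_mul c)
  have iC : Integrable (fun y => (p y / q y - 1) ^ 2 * q y) μ :=
    integrable_weightVar_integrand hq0 hpi hqi hW
  -- the quadratic `t ↦ ∫ ((f − c) − t(w − 1))² q = A − 2tB + t²C ≥ 0`
  have hquad : ∀ t : ℝ, 0 ≤ C * (t * t) + (-2 * B) * t + A := by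
    intro t
    have e : ∀ y, ((f y - c) - t * (p y / q y - 1)) ^ 2 * q y
        = (t * t) * ((p y / q y - 1) ^ 2 * q y) - 2 * t * ((p y / q y - 1) * (f y - c) * q y)
          + (f y - c) ^ 2 * q y := fun y => by ring
    have hnn : 0 ≤ ∫ y, ((f y - c) - t * (p y / q y - 1)) ^ 2 * q y ∂μ :=
      integral_nonneg fun y => mul_nonneg (sq_nonneg _) (hq0 y).le
    simp_rw [e] at hnn
    have i1 : Integrable (fun y => (t * t) * ((p y / q y - 1) ^ 2 * q y)) μ := iC.const_mul _
    have i2 : Integrable (fun y => 2 * t * ((p y / q y - 1) * (f y - c) * q y)) μ :=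
      iB.const_mul _
    have i12 : Integrable (fun y => (t * t) * ((p y / q y - 1) ^ 2 * q y)
        - 2 * t * ((p y / q y - 1) * (f y - c) * q y)) μ := i1.sub i2
    rw [integral_add i12 iA, integral_sub i1 i2, integral_const_mul, integral_const_mul, ← hA,
      ← hB, ← hC] at hnn
    linarith
  have hdisc := discrim_le_zero hquad
  rw [discrim] at hdisc
  nlinarith [hdisc]

/-- **`|bias| ≤ σ_q^{(c)}(f)·√(1/ESS − 1)`** — the square-rooted form. [folklore] -/
theorem abs_uncorrected_bias_le_integral (hq0 : ∀ y, 0 < q y) (hpi : Integrable p μ)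
    (hp1 : ∫ y, p y ∂μ = 1) (hqi : Integrable q μ) (hq1 : ∫ y, q y ∂μ = 1)
    (hW : Integrable (fun y => p y / q y * p y) μ) (hfp : Integrable (fun y => f y * p y) μ)
    (hfq : Integrable (fun y => f y * q y) μ) (hf2 : Integrable (fun y => f y ^ 2 * q y) μ)
    (c : ℝ) :
    |(∫ y, f y * p y ∂μ) - ∫ y, f y * q y ∂μ|
      ≤ Real.sqrt (∫ y, (f y - c) ^ 2 * q y ∂μ)
        * Real.sqrt (∫ y, (p y / q y - 1) ^ 2 * q y ∂μ) := by
  have h := sq_uncorrected_bias_le_integral hq0 hpi hp1 hqi hq1 hW hfp hfq hf2 c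
  have hA : 0 ≤ ∫ y, (f y - c) ^ 2 * q y ∂μ :=
    integral_nonneg fun y => mul_nonneg (sq_nonneg _) (hq0 y).le
  rw [← Real.sqrt_mul hA, ← Real.sqrt_sq_eq_abs]
  exact Real.sqrt_le_sqrt h

/-- **EQUALITY FOR OBSERVABLES AFFINE IN THE WEIGHT**: for `f = a + b·w` the bias is exactly
`b·∫ (w − 1)² q dμ = b·(1/ESS − 1)`; the weight itself (`a = 0`, `b = 1`) is under-reported by the
uncorrected sampler by exactly `χ²(p‖q)`. [ours] -/
theorem uncorrected_bias_affine_integral (hq0 : ∀ y, 0 < q y) (hpi : Integrable p μ)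
    (hp1 : ∫ y, p y ∂μ = 1) (hqi : Integrable q μ) (hq1 : ∫ y, q y ∂μ = 1) (a b : ℝ)
    (hfp : Integrable (fun y => (a + b * (p y / q y)) * p y) μ)
    (hfq : Integrable (fun y => (a + b * (p y / q y)) * q y) μ) :
    (∫ y, (a + b * (p y / q y)) * p y ∂μ) - ∫ y, (a + b * (p y / q y)) * q y ∂μ
      = b * ∫ y, (p y / q y - 1) ^ 2 * q y ∂μ := by
  rw [uncorrected_bias_eq_weightCov_integral (f := fun y => a + b * (p y / q y)) hq0 hpi hp1 hqi
      hq1 hfp hfq (a + b), ← integral_const_mul]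
  refine integral_congr_ae (Filter.Eventually.of_forall fun y => ?_)
  simp only
  ring

/-- **The same with `V = W − 1`** (`W = ∫ (p/q) p dμ = 1/κ`): the squared bias is at most
`(∫ (f − c)² q)·(W − 1)`. [folklore] -/
theorem sq_uncorrected_bias_le_weightMoment (hq0 : ∀ y, 0 < q y) (hpi : Integrable p μ)
    (hp1 : ∫ y, p y ∂μ = 1) (hqi : Integrable q μ) (hq1 : ∫ y, q y ∂μ = 1)
    (hW : Integrable (fun y => p y / q y * p y) μ) (hfp : Integrable (fun y => f y * p y) μ)
    (hfq : Integrable (fun y => f y * q y) μ) (hf2 : Integrable (fun y => f y ^ 2 * q y) μ)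
    (c : ℝ) :
    ((∫ y, f y * p y ∂μ) - ∫ y, f y * q y ∂μ) ^ 2
      ≤ (∫ y, (f y - c) ^ 2 * q y ∂μ) * ((∫ y, p y / q y * p y ∂μ) - 1) := by
  rw [← AllPairsVariance.integral_weightVar_eq hpi hp1 hq0 hqi hq1 hW]
  exact sq_uncorrected_bias_le_integral hq0 hpi hp1 hqi hq1 hW hfp hfq hf2 c

end Uncorrected

end Summit.Ventures.LatticeQCDFlow.Scoring
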